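import Literature.MathematicalPhysics.QuantumLattice.FinDimSpectrumProofs
import HarnessLib

/-!
# Discharges: the smallest eigenvalue and the eigenvalue form of the spectral gap

Trunk T-QLATTICE. Second sibling proof file of
`Literature/MathematicalPhysics/QuantumLattice/FinDimSpectrum.lean` (the first is
`FinDimSpectrumProofs.lean`, whose helpers `Matrix.isSelfAdjoint_toEuclideanCLM_iff` and
`Matrix.IsHermitian.re_image_spectrum_toEuclideanCLM` are reused here). It discharges two named
facts (`def X : Prop`, D-0014) of that file as `theorem X_holds : X`; no statement or definition
is introduced or changed:

* `Matrix.groundEnergy_eq_eigenvalues₀_last_holds : groundEnergy_eq_eigenvalues₀_last` — on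
  `k + 1` basis states the ground energy `E₀ = inf re σ(A)` of a Hermitian matrix is the *last*
  entry `eigenvalues₀ (Fin.last k)` of Mathlib's decreasingly sorted enumeration
  `Matrix.IsHermitian.eigenvalues₀` (`eigenvalues₀_antitone`);
* `Matrix.hasSpectralGap_iff_eigenvalues₀_holds : hasSpectralGap_iff_eigenvalues₀` — on `k + 2`
  basis states, `A.HasSpectralGap Δ` (the "unique gapped ground state" predicate transported from
  `ContinuousLinearMap.HasSpectralGap` along `Matrix.toEuclideanCLM`: `A` self-adjoint, `0 < Δ`,
  `E₀` a simple eigenvalue, `re σ(A) ⊆ {E₀} ∪ [E₀ + Δ, ∞)`) holds iff `0 < Δ` and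
  `E₀ + Δ ≤ E₁`, where `E₀ = eigenvalues₀ (Fin.last (k+1))` is the lowest and
  `E₁ = eigenvalues₀ k` the second lowest sorted eigenvalue (counted with multiplicity).

Helpers: `IsHermitian.eigenvalues_equivOfCardEq` (`eigenvalues (e j) = eigenvalues₀ j` for the
reindexing `e = Fintype.equivOfCardEq _` used in the definition of `eigenvalues`),
`IsHermitian.eigenvalues₀_last_le(_eigenvalues)` (the last sorted eigenvalue is the least), and
`IsHermitian.hasSpectralGap_iff_card_filter` (`HasSpectralGap` unfolded in eigenvalue terms for an
arbitrary index type: `0 < Δ`, `#{i | λᵢ = E₀} = 1`, `range λ ⊆ {E₀} ∪ [E₀ + Δ, ∞)`).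

## Sources

H. Tasaki, *Physics and Mathematics of Quantum Many-Body Systems* (2020), §2.1 (ground states and
the energy gap of a finite-volume Hamiltonian; the cite carried by both facts). The finite-volume
notion "a unique normalized ground state accompanied by a nonzero energy gap that is not less than
a constant `ΔE > 0`" is printed verbatim in H. Tasaki, *The Lieb–Schultz–Mattis theorem: a
topological point of view*, arXiv:2202.06243 (2022), §2.2 (PDF p. 6), cf. p. 4 ("in a finite
system, a unique ground state is necessarily accompanied by a nonzero energy gap") and
Definition 2.5 (p. 5). Reed–Simon IV, §XIII.1 (finite-dimensional min–max: the sorted eigenvalues).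
Everything here is finite-dimensional linear algebra over Mathlib's spectral theorem for Hermitian
matrices (`Matrix.IsHermitian.spectrum_eq_image_range`, `eigenvalues₀_antitone`,
`LinearMap.IsSymmetric.card_filter_eigenvalues_eq` via `IsHermitian.card_filter_eigenvalues_eq`).

## Proof notes

With `e : Fin (card n) ≃ n` the reindexing equivalence, `eigenvalues = eigenvalues₀ ∘ e.symm` by
definition. Antitonicity gives `eigenvalues₀ (Fin.last _) ≤ eigenvalues₀ j` for all `j`, so
`E₀ = ⨅ i, λᵢ` (`groundEnergy_eq_iInf_eigenvalues_holds`) is the last sorted eigenvalue. For the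
gap: every index `i` either is `e (Fin.last (k+1))` or has `e.symm i ≤ k`, hence `λᵢ ≥ E₁`.
(⇒) `E₁ ∈ range λ = re σ(A) ⊆ {E₀} ∪ [E₀ + Δ, ∞)`; the alternative `E₁ = E₀` would put the two
distinct indices `e (k+1)`, `e k` into `{i | λᵢ = E₀}`, contradicting `#{i | λᵢ = E₀} = 1`.
(⇐) if `E₀ + Δ ≤ E₁` with `Δ > 0` then `{i | λᵢ = E₀} = {e (Fin.last (k+1))}` and every `λᵢ` is
`E₀` or `≥ E₁ ≥ E₀ + Δ`; self-adjointness is hermiticity (`isSelfAdjoint_toEuclideanCLM_iff`).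
-/

noncomputable section

open scoped Matrix.Norms.L2Operator ComplexOrder MatrixOrder InnerProductSpace

namespace Matrix

open Literature.MathematicalPhysics.QuantumLattice

variable {n : Type*} [Fintype n] [DecidableEq n]

/-! ### The last sorted eigenvalue is the ground energy -/

/-- Reindexing Mathlib's two eigenvalue enumerations of a Hermitian matrix along
`e = Fintype.equivOfCardEq _ : Fin (card n) ≃ n`: `eigenvalues (e j) = eigenvalues₀ j` (this is
the definition of `Matrix.IsHermitian.eigenvalues`, which is `eigenvalues₀ ∘ e.symm`). [folklore] -/
theorem IsHermitian.eigenvalues_equivOfCardEq {A : Matrix n n ℂ} (hA : A.IsHermitian)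
    (j : Fin (Fintype.card n)) :
    hA.eigenvalues (Fintype.equivOfCardEq (Fintype.card_fin (Fintype.card n)) j) =
      hA.eigenvalues₀ j := by
  simp [IsHermitian.eigenvalues]

/-- On `k + 1` basis states the last sorted eigenvalue `eigenvalues₀ (Fin.last k)` is the least
of the sorted eigenvalues (Mathlib sorts `eigenvalues₀` decreasingly,
`Matrix.IsHermitian.eigenvalues₀_antitone`). [folklore] -/
theorem IsHermitian.eigenvalues₀_last_le {A : Matrix n n ℂ} (hA : A.IsHermitian) {k : ℕ}
    (hn : Fintype.card n = k + 1) (j : Fin (Fintype.card n)) :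
    hA.eigenvalues₀ (Fin.cast hn.symm (Fin.last k)) ≤ hA.eigenvalues₀ j :=
  hA.eigenvalues₀_antitone (Fin.le_iff_val_le_val.mpr
    (by have := j.isLt; simp only [Fin.val_cast, Fin.val_last]; omega))

/-- On `k + 1` basis states every eigenvalue is at least the last sorted eigenvalue
`eigenvalues₀ (Fin.last k)`. [folklore] -/
theorem IsHermitian.eigenvalues₀_last_le_eigenvalues {A : Matrix n n ℂ} (hA : A.IsHermitian)
    {k : ℕ} (hn : Fintype.card n = k + 1) (i : n) :
    hA.eigenvalues₀ (Fin.cast hn.symm (Fin.last k)) ≤ hA.eigenvalues i :=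
  hA.eigenvalues₀_last_le hn _

/-- Discharge of the named fact `groundEnergy_eq_eigenvalues₀_last`: on `k + 1` basis states the
ground energy of a Hermitian matrix is the last sorted eigenvalue `eigenvalues₀ (Fin.last k)`.
The ground energy is the infimum of the eigenvalues (`groundEnergy_eq_iInf_eigenvalues_holds`),
and the infimum of the antitone enumeration `eigenvalues₀` on `Fin (k + 1)` is its last entry.
Tasaki (2020) §2.1 (ground-state energy of a finite-volume Hamiltonian; the cite carried by the
fact); Reed–Simon IV §XIII.1 (finite-dimensional min–max). [cite: Tasaki2020, §2.1] -/
theorem groundEnergy_eq_eigenvalues₀_last_holds : groundEnergy_eq_eigenvalues₀_last (n := n) := by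
  intro A hA k hn
  haveI : Nonempty n := Fintype.card_pos_iff.mp (by omega)
  refine le_antisymm ?_ ?_
  · have h := groundEnergy_le_eigenvalues hA
      (Fintype.equivOfCardEq (Fintype.card_fin (Fintype.card n)) (Fin.cast hn.symm (Fin.last k)))
    rwa [hA.eigenvalues_equivOfCardEq] at h
  · rw [groundEnergy_eq_iInf_eigenvalues_holds hA]
    exact le_ciInf fun i => hA.eigenvalues₀_last_le_eigenvalues hn i

/-! ### The spectral gap in eigenvalue terms -/

/-- `Matrix.HasSpectralGap` in eigenvalue terms, for an arbitrary (finite) index type: for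
Hermitian `A`, `A.HasSpectralGap Δ` iff `0 < Δ`, the ground energy `E₀` has multiplicity one
among the `eigenvalues`, and every eigenvalue is `E₀` or `≥ E₀ + Δ`. This is the transported
`ContinuousLinearMap.HasSpectralGap` unfolded with `isSelfAdjoint_toEuclideanCLM_iff`,
`finrank_eigenspace_toEuclideanLin`, `IsHermitian.card_filter_eigenvalues_eq` (simplicity of `E₀`
as `#{i | λᵢ = E₀} = 1`) and `IsHermitian.re_image_spectrum_toEuclideanCLM` (`re σ(A) = range λ`).
[folklore] -/
theorem IsHermitian.hasSpectralGap_iff_card_filter {A : Matrix n n ℂ} (hA : A.IsHermitian)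
    (Δ : ℝ) :
    A.HasSpectralGap Δ ↔ 0 < Δ ∧
      (Finset.univ.filter fun i => hA.eigenvalues i = A.groundEnergy).card = 1 ∧
      Set.range hA.eigenvalues ⊆ {A.groundEnergy} ∪ Set.Ici (A.groundEnergy + Δ) := by
  have key : A.HasSpectralGap Δ ↔
      IsSelfAdjoint (toEuclideanCLM (n := n) (𝕜 := ℂ) A) ∧ 0 < Δ ∧
        Module.finrank ℂ (Module.End.eigenspace (toEuclideanLin A) ((A.groundEnergy : ℝ) : ℂ))
          = 1 ∧
        RCLike.re '' spectrum ℂ (toEuclideanCLM (n := n) (𝕜 := ℂ) A) ⊆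
          {A.groundEnergy} ∪ Set.Ici (A.groundEnergy + Δ) :=
    Iff.rfl
  rw [key, finrank_eigenspace_toEuclideanLin, ← hA.card_filter_eigenvalues_eq,
    hA.re_image_spectrum_toEuclideanCLM, isSelfAdjoint_toEuclideanCLM_iff]
  exact ⟨fun h => h.2, fun h => ⟨hA, h⟩⟩

/-- Discharge of the named fact `hasSpectralGap_iff_eigenvalues₀` (eigenvalue form of the unique
gapped ground state on `k + 2` basis states): `A.HasSpectralGap Δ ↔ 0 < Δ ∧ E₀ + Δ ≤ E₁` with
`E₀ = eigenvalues₀ (Fin.last (k+1))` the lowest and `E₁ = eigenvalues₀ k` the second lowest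
sorted eigenvalue. The ground energy is `E₀` (`groundEnergy_eq_eigenvalues₀_last_holds`); by
`hasSpectralGap_iff_card_filter` the predicate says `#{i | λᵢ = E₀} = 1` and
`λᵢ ∈ {E₀} ∪ [E₀ + Δ, ∞)`; and every index other than the last carries `λᵢ ≥ E₁`
(antitonicity), so both conjuncts together are exactly `E₀ + Δ ≤ E₁` (given `Δ > 0`). This is
the finite-volume notion "a unique normalized ground state accompanied by a nonzero energy gap
that is not less than a constant `ΔE > 0`": Tasaki (2020) §2.1 (the cite carried by the fact);
printed verbatim in Tasaki, arXiv:2202.06243 (2022), §2.2 (PDF p. 6); Reed–Simon IV §XIII.1.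
[cite: Tasaki2020, §2.1] -/
theorem hasSpectralGap_iff_eigenvalues₀_holds : hasSpectralGap_iff_eigenvalues₀ (n := n) := by
  intro A hA k hn Δ
  set j₀ : Fin (Fintype.card n) := Fin.cast hn.symm (Fin.last (k + 1)) with hj₀
  set j₁ : Fin (Fintype.card n) := Fin.cast hn.symm (Fin.castSucc (Fin.last k)) with hj₁
  have hj₀v : j₀.val = k + 1 := by rw [hj₀, Fin.val_cast, Fin.val_last]
  have hj₁v : j₁.val = k := by rw [hj₁, Fin.val_cast, Fin.val_castSucc, Fin.val_last]
  -- the ground energy is the last sorted eigenvalue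
  have hE₀ : A.groundEnergy = hA.eigenvalues₀ j₀ := groundEnergy_eq_eigenvalues₀_last_holds hA hn
  -- `eigenvalues = eigenvalues₀ ∘ e.symm` for the reindexing equivalence `e`
  obtain ⟨e, hev⟩ : ∃ e : Fin (Fintype.card n) ≃ n,
      ∀ i, hA.eigenvalues i = hA.eigenvalues₀ (e.symm i) :=
    ⟨Fintype.equivOfCardEq (Fintype.card_fin (Fintype.card n)), fun i => rfl⟩
  have hev' : ∀ j, hA.eigenvalues (e j) = hA.eigenvalues₀ j := fun j => by
    rw [hev, Equiv.symm_apply_apply]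
  have hne : e j₀ ≠ e j₁ := fun h' => by
    have := congrArg Fin.val (e.injective h')
    omega
  -- every index is the last one or carries an eigenvalue `≥ E₁`
  have hdich : ∀ i, e.symm i = j₀ ∨ hA.eigenvalues₀ j₁ ≤ hA.eigenvalues i := by
    intro i
    by_cases h : e.symm i = j₀
    · exact Or.inl h
    · refine Or.inr ?_
      rw [hev i]
      refine hA.eigenvalues₀_antitone (Fin.le_iff_val_le_val.mpr ?_)
      have h1 := (e.symm i).isLt
      have h2 : (e.symm i).val ≠ j₀.val := fun h' => h (Fin.ext h')
      omega
  rw [hA.hasSpectralGap_iff_card_filter, hE₀]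
  constructor
  · rintro ⟨hΔ, hcard, hsub⟩
    refine ⟨hΔ, ?_⟩
    have hmem : hA.eigenvalues₀ j₁ ∈ Set.range hA.eigenvalues := ⟨e j₁, hev' j₁⟩
    rcases (Set.mem_union _ _ _).mp (hsub hmem) with h | h
    · -- `E₁ = E₀`: then `E₀` has multiplicity `≥ 2`, contradicting simplicity
      exfalso
      rw [Set.mem_singleton_iff] at h
      obtain ⟨a, ha⟩ := Finset.card_eq_one.mp hcard
      have hmem₀ : e j₀ ∈ Finset.univ.filter fun i => hA.eigenvalues i = hA.eigenvalues₀ j₀ := by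
        rw [Finset.mem_filter, hev']
        exact ⟨Finset.mem_univ _, rfl⟩
      have hmem₁ : e j₁ ∈ Finset.univ.filter fun i => hA.eigenvalues i = hA.eigenvalues₀ j₀ := by
        rw [Finset.mem_filter, hev']
        exact ⟨Finset.mem_univ _, h⟩
      rw [ha, Finset.mem_singleton] at hmem₀ hmem₁
      exact hne (hmem₀.trans hmem₁.symm)
    · exact Set.mem_Ici.mp h
  · rintro ⟨hΔ, hgap⟩
    refine ⟨hΔ, ?_, ?_⟩
    · -- simplicity: only the last index carries the eigenvalue `E₀`
      rw [Finset.card_eq_one]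
      refine ⟨e j₀, Finset.ext fun i => ?_⟩
      rw [Finset.mem_filter, Finset.mem_singleton]
      constructor
      · rintro ⟨-, hi⟩
        rcases hdich i with h | h
        · rw [← h, Equiv.apply_symm_apply]
        · exfalso
          linarith
      · rintro rfl
        exact ⟨Finset.mem_univ _, hev' j₀⟩
    · -- the gap: every eigenvalue is `E₀` or `≥ E₁ ≥ E₀ + Δ`
      rintro x ⟨i, rfl⟩
      rw [Set.mem_union, Set.mem_singleton_iff, Set.mem_Ici]
      rcases hdich i with h | h
      · exact Or.inl (by rw [hev, h])
      · exact Or.inr (le_trans hgap h)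

end Matrix
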